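import Summits.HodgeConjecture.HodgeConjecture.Theorems.R90S4EpsTubeEq                  -- ★ p864077 (this seat): TUBE-EQ `exists_norm_mem_iff_of_transport`, `eq_of_isConj_of_mem_cartan`, `isStablyConjGAt_of_isEpsNormPair_of_isEpsNormPair` (brings ★ dict)
import Summits.HodgeConjecture.HodgeConjecture.Theorems.R90S4NormStableClassBijection    -- ★ p863348 (R90-C131-p03, (W5-B3) file 3): `exists_epsNorm_eq_coe` (every `γ ∈ G_v` is a norm, Prop. 3.11.1 (b))
import Summits.HodgeConjecture.HodgeConjecture.Theorems.R90S4TwistedCartanNormFibres     -- ★ p863634 (R90-C131-p03, α): `isEpsNormPair_of_epsNorm_eq_coe`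
import Summits.HodgeConjecture.HodgeConjecture.Theorems.R90S4StableTransportDictTrivialTypes  -- ★ p864030 (this seat): `mk_mem_stableIndexSet`
import HarnessLib

/-!
# R90-TF · S4 «Ch. 13.1–2», T-WIF road — REACHABILITY = TUBE COINCIDENCE: the fibre count `N k i` of a member package is non-zero EXACTLY when the ε-tubes over `T_k` and
# `T_i` coincide (Rogawski 1990, §12.5 pp. 182, 186; §3.11 Prop. 3.11.1 (b) p. 34)

Cell `hodgecm-mathlib`, crux H413 (`stmt-HodgeConjecture-24833`, lane `--supports … --as helper`), route of record `HCCMUnconditional` (no route verbs;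
count-neutral).  Programme R90-TF, section S4, dealer K2E2-plan (g7) (hint (a) 2026-09-05T01:23Z; proposal 01:27:48Z); seat K2E3-p12 (g10).  THE BRIDGE between the two
indexings of a stable class of members of the Cartan system `C`: ★ `R90S4WeylCountFiner`'s T-count `IsFinerCount.tCount` sums over «`N k i ≠ 0`» (the VISIBLE fibre counts of
the member packages of ★ `isStableTransportDict_of_forall_member`), while the (B1) T-WIF assembly (HEADS v2 §4′ ∕ v3) partitions the ε-regular set by ★ TUBE-EQ
`tube_iff_or_disjoint_of_dict` — «the tubes over `T_k` and `T_i` coincide».  HERE: at the level of a member package `(τ, e)` of `T_k` with clauses (S) and (B),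
`(∃ j, τ j = T_i) ↔ (∀ δ, δ ∈ tube(T_k) ↔ δ ∈ tube(T_i))`, hence with the fibre counts `N k i = #{j : τ j = T_i}`: **`N k i ≠ 0 ↔` the tubes coincide** — for ALL members at
once from the `hmem` rows of ★ `isStableTransportDict_of_forall_member` (same binder, so the (DICT) payer proves nothing new).  (⇒) ★ TUBE-EQ §1; (⇐) every `γ ∈ G_v` is a norm
(★ `exists_epsNorm_eq_coe`, Prop. 3.11.1 (b)): a `δ` with `N δ = γ₀` (`γ₀` the regular generator of `T_k`) lies in tube(`T_k`), hence in tube(`T_i`), so its two norms are stably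
conjugate (★ TUBE-EQ §2) and clause (B) + ★ `eq_of_isConj_of_mem_cartan` produce `j` with `τ j = T_i`.  Tube letter as in ★ TUBE-EQ: `∃ t : ↥T, IsRegularElt (↑t).val ∧
IsEpsNormPair L (splitFormGL L) v δ ↑t`.

## CONTENTS
* §1 `exists_target_iff_tube_iff` — package level: `(∃ j, τ j = i) ↔ ∀ δ, (tube_k δ ↔ tube_i δ)`.
* §2 **`fibreCount_ne_zero_iff_tube_iff_of_forall_member`** — for the `hmem` rows of ★ `isStableTransportDict_of_forall_member` (visible `μ`, `N`): `∀ k i, N k i ≠ 0 ↔ ∀ δ, (tube_k δ ↔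
  tube_i δ)`; so ★ `IsFinerCount.tCount`'s filter `N k · ≠ 0` IS «the members whose tube is `T_k`'s», BY NAME.

HONEST LABEL: HC_CM is proved only modulo the 7 printed citations (2 remaining named inputs: hLiu418 = stmt-HodgeConjecture-24832, h413 = stmt-HodgeConjecture-24833) until rung 0
closes.  Bookkeeping between ★ letters; one input of the (B1) T-WIF assembly behind the OPEN (W-NP).  REL ≠ ★ ≠ BUILT.  Theorems only; no instance, no notation, no `sorry`.

## References
* [Rogawski1990] J. D. Rogawski, *Automorphic Representations of Unitary Groups in Three Variables*, Ann. of Math. Stud. 123 (1990), §12.5 pp. 182, 186; §3.11 Prop. 3.11.1 (b) p. 34;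
  §3.6 pp. 28–31.
-/

set_option autoImplicit false
set_option linter.dupNamespace false

noncomputable section

open MeasureTheory Measure Set Filter Topology Function NumberField IsDedekindDomain
open Literature.MeasureTheory.Group
open Literature.NumberTheory.Automorphic Literature.NumberTheory.Automorphic.UnitaryGroup Literature.NumberTheory.Rogawski1990
open Literature.NumberTheory.Rogawski1990.Ch4Sec10
open Summit.HodgeConjecture.HodgeConjecture.Cruxes.H413
open scoped ENNReal NNReal MatrixGroups Pointwise

namespace Summit.HodgeConjecture.HodgeConjecture.R90.S4

section TubeReachability

variable (L : Type) [Field L] [NumberField L] [IsCMField L] (v : HeightOneSpectrum (𝓞 ↥(maximalRealSubfield L)))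

/-! ## §1 Package level: a target `T_i` of the transports of `T_k` ⟺ the tubes over `T_k`, `T_i` coincide -/

variable {L v} in
/-- **REACHABILITY = TUBE COINCIDENCE, package level.**  Let `T_k ∈ C` carry transports `e j : T_k ≃ₜ* T_{τ j}` (`j < m`) with (S) `e j t ∼_{st} t` and (B) `j ↦ ⟦e j t⟧` a bijection onto
`{c | t ∼_{st} out c}` for regular `t` (a member package), and let `C` have the `hZ`, `hirr` letters of ★ CARTAN-ALL.  Then for every member `T_i`:
`(∃ j, τ j = i) ↔ (∀ δ, δ ∈ tube(T_k) ↔ δ ∈ tube(T_i))`.  (⇒) ★ `exists_norm_mem_iff_of_transport`; (⇐) a `δ` with `N δ = γ₀`, `γ₀` the regular generator of `T_k`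
(★ `exists_epsNorm_eq_coe`), lies in both tubes, its two norms are stably conjugate, and (B) + ★ `eq_of_isConj_of_mem_cartan` name the index `j`.
[cite: Rogawski1990, §12.5 pp. 182, 186; §3.11 Prop. 3.11.1 (b) p. 34] -/
theorem exists_target_iff_tube_iff {C : Finset (Subgroup (Gqs L v))}
    (hZ : ∀ T ∈ C, ∃ γ₀ : Gqs L v, IsRegularElt (γ₀.val : GL (Fin 3) (LocalRing L v)) ∧ T = Subgroup.centralizer ({γ₀} : Set (Gqs L v)))
    (hirr : ∀ T ∈ C, ∀ T' ∈ C, T ≠ T' → ∀ y : Gqs L v, ¬ ∀ h : Gqs L v, h ∈ T' ↔ y⁻¹ * h * y ∈ T)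
    (k : ↥C) {m : ℕ} (τ : Fin m → ↥C) (e : ∀ j : Fin m, ↥(k : Subgroup (Gqs L v)) ≃ₜ* ↥((τ j : ↥C) : Subgroup (Gqs L v)))
    (hS : ∀ (j : Fin m) (t : ↥(k : Subgroup (Gqs L v))),
      IsStablyConjGAt L (R90.S4.splitFormGL L) v (t : Gqs L v) ((e j t : ↥((τ j : ↥C) : Subgroup (Gqs L v))) : Gqs L v))
    (hB : ∀ t : ↥(k : Subgroup (Gqs L v)), IsRegularElt (((t : Gqs L v)).val : GL (Fin 3) (LocalRing L v)) →
      Set.BijOn (fun j : Fin m => ConjClasses.mk ((e j t : ↥((τ j : ↥C) : Subgroup (Gqs L v))) : Gqs L v)) Set.univ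
        {c : ConjClasses (Gqs L v) | IsStablyConjGAt L (R90.S4.splitFormGL L) v (t : Gqs L v) (Quotient.out c)})
    (i : ↥C) :
    (∃ j : Fin m, τ j = i) ↔
      ∀ δ : GtLoc L v,
        (∃ t : ↥(k : Subgroup (Gqs L v)), IsRegularElt (((t : Gqs L v)).val : GL (Fin 3) (LocalRing L v)) ∧ IsEpsNormPair L (R90.S4.splitFormGL L) v δ (t : Gqs L v)) ↔
          ∃ t' : ↥(i : Subgroup (Gqs L v)), IsRegularElt (((t' : Gqs L v)).val : GL (Fin 3) (LocalRing L v)) ∧ IsEpsNormPair L (R90.S4.splitFormGL L) v δ (t' : Gqs L v) := by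
  constructor
  · rintro ⟨j, rfl⟩ δ
    exact exists_norm_mem_iff_of_transport (e j) (hS j) δ
  · intro htube
    -- the regular generator `γ₀ ∈ T_k` and a `δ` with `N δ = γ₀`
    obtain ⟨γ₀, hγ₀, hT⟩ := hZ k k.2
    have hmem : γ₀ ∈ (k : Subgroup (Gqs L v)) := hT.ge (Subgroup.mem_centralizer_iff.mpr fun g hg => by rw [Set.mem_singleton_iff.mp hg])
    obtain ⟨δ, hδ, -, -⟩ := exists_epsNorm_eq_coe L (R90.S4.splitFormGL L) v γ₀
    have hk : ∃ t : ↥(k : Subgroup (Gqs L v)), IsRegularElt (((t : Gqs L v)).val : GL (Fin 3) (LocalRing L v)) ∧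
        IsEpsNormPair L (R90.S4.splitFormGL L) v δ (t : Gqs L v) :=
      ⟨⟨γ₀, hmem⟩, hγ₀, isEpsNormPair_of_epsNorm_eq_coe hδ⟩
    obtain ⟨t', -, hδt'⟩ := (htube δ).mp hk
    -- the two norms `γ₀`, `t′` of `δ` are stably conjugate; (B) lists `⟦t′⟧`
    have hst : IsStablyConjGAt L (R90.S4.splitFormGL L) v (((⟨γ₀, hmem⟩ : ↥(k : Subgroup (Gqs L v))) : Gqs L v)) (t' : Gqs L v) :=
      isStablyConjGAt_of_isEpsNormPair_of_isEpsNormPair (isEpsNormPair_of_epsNorm_eq_coe hδ) hδt'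
    have hcls : ConjClasses.mk (t' : Gqs L v) ∈
        {c : ConjClasses (Gqs L v) | IsStablyConjGAt L (R90.S4.splitFormGL L) v (((⟨γ₀, hmem⟩ : ↥(k : Subgroup (Gqs L v))) : Gqs L v)) (Quotient.out c)} :=
      IsConj.trans hst (mk_mem_stableIndexSet (t' : Gqs L v))
    obtain ⟨j, -, hj⟩ := (hB ⟨γ₀, hmem⟩ hγ₀).surjOn hcls
    have hconj : IsConj ((e j ⟨γ₀, hmem⟩ : ↥((τ j : ↥C) : Subgroup (Gqs L v))) : Gqs L v) (t' : Gqs L v) := ConjClasses.mk_eq_mk_iff_isConj.mp hj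
    have hreg : IsRegularElt ((((e j ⟨γ₀, hmem⟩ : ↥((τ j : ↥C) : Subgroup (Gqs L v))) : Gqs L v)).val : GL (Fin 3) (LocalRing L v)) :=
      isRegularElt_of_isConj (hS j ⟨γ₀, hmem⟩) hγ₀
    exact ⟨j, eq_of_isConj_of_mem_cartan hZ hirr (e j ⟨γ₀, hmem⟩) hreg t' hconj⟩

/-! ## §2 For the member packages of ★ `isStableTransportDict_of_forall_member`: `N k i ≠ 0` ⟺ the tubes coincide -/

variable {L v} in
/-- **`N k i ≠ 0` IFF THE ε-TUBES OVER `T_k` AND `T_i` COINCIDE**, for every pair of members, from the SAME `hmem` rows the (DICT) payer hands to ★ `isStableTransportDict_of_forall_member`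
(visible class counts `μ` and fibre counts `N`; `hZ`, `hirr` of ★ CARTAN-ALL).  So the filter «`N k · ≠ 0`» of ★ `IsFinerCount.tCount` ((WEYL-COUNT-T)) is BY NAME the index set «members
whose tube is `T_k`'s» of the (B1) assembly's partition (★ `tube_iff_or_disjoint_of_dict`). [cite: Rogawski1990, §12.5 pp. 182, 186; §3.6 pp. 28–31] -/
theorem fibreCount_ne_zero_iff_tube_iff_of_forall_member {C : Finset (Subgroup (Gqs L v))}
    (hZ : ∀ T ∈ C, ∃ γ₀ : Gqs L v, IsRegularElt (γ₀.val : GL (Fin 3) (LocalRing L v)) ∧ T = Subgroup.centralizer ({γ₀} : Set (Gqs L v)))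
    (hirr : ∀ T ∈ C, ∀ T' ∈ C, T ≠ T' → ∀ y : Gqs L v, ¬ ∀ h : Gqs L v, h ∈ T' ↔ y⁻¹ * h * y ∈ T)
    (μ : ↥C → ℕ) (N : ↥C → ↥C → ℕ)
    (hmem : ∀ i : ↥C, ∃ (k : ℕ) (τ : Fin k → ↥C) (e : ∀ j : Fin k, ↥(i : Subgroup (Gqs L v)) ≃ₜ* ↥((τ j : ↥C) : Subgroup (Gqs L v))),
      k = μ i ∧ (∀ k' : ↥C, Nat.card {j : Fin k // τ j = k'} = N i k') ∧
      (∀ (j : Fin k) (t : ↥(i : Subgroup (Gqs L v))),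
          IsStablyConjGAt L (R90.S4.splitFormGL L) v (t : Gqs L v) ((e j t : ↥((τ j : ↥C) : Subgroup (Gqs L v))) : Gqs L v)) ∧
      (∀ (j : Fin k) (t : ↥(i : Subgroup (Gqs L v))), IsRegularElt (((t : Gqs L v)).val : GL (Fin 3) (LocalRing L v)) →
          cartanWeight L v ((τ j : ↥C) : Subgroup (Gqs L v)) (e j t) = cartanWeight L v (i : Subgroup (Gqs L v)) t) ∧
      (∀ t : ↥(i : Subgroup (Gqs L v)), IsRegularElt (((t : Gqs L v)).val : GL (Fin 3) (LocalRing L v)) →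
          Set.BijOn (fun j : Fin k => ConjClasses.mk ((e j t : ↥((τ j : ↥C) : Subgroup (Gqs L v))) : Gqs L v)) Set.univ
            {c : ConjClasses (Gqs L v) | IsStablyConjGAt L (R90.S4.splitFormGL L) v (t : Gqs L v) (Quotient.out c)}))
    (k i : ↥C) :
    N k i ≠ 0 ↔
      ∀ δ : GtLoc L v,
        (∃ t : ↥(k : Subgroup (Gqs L v)), IsRegularElt (((t : Gqs L v)).val : GL (Fin 3) (LocalRing L v)) ∧ IsEpsNormPair L (R90.S4.splitFormGL L) v δ (t : Gqs L v)) ↔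
          ∃ t' : ↥(i : Subgroup (Gqs L v)), IsRegularElt (((t' : Gqs L v)).val : GL (Fin 3) (LocalRing L v)) ∧ IsEpsNormPair L (R90.S4.splitFormGL L) v δ (t' : Gqs L v) := by
  obtain ⟨m, τ, e, -, hcard, hS, -, hB⟩ := hmem k
  rw [← hcard i, ← Nat.pos_iff_ne_zero, Finite.card_pos_iff, nonempty_subtype]
  exact exists_target_iff_tube_iff hZ hirr k τ e hS hB i

end TubeReachability

end Summit.HodgeConjecture.HodgeConjecture.R90.S4

end
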